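import Summits.CriticalPhenomena.CardyFormulaZ2.Theorems.DyadicBetaRigidityDyadicLatticeBetaLawStubRectSubseqLimitsBoxes

/-!
# Stub S5a `stub_rectSubseqLimits` of line `Sketch` (crux `DyadicLatticeBetaLaw`,
# stmt-CriticalPhenomena-18183, route DyadicBetaRigidity of `CardyFormulaZ2`)

Pure percolation, no conformal geometry. For the left–right family `Q w` and the bottom–top
family `Q' w` of corner-marked boxes `(0, w) × (0, 1)` (specified by carrier and arcs `0, 2`),
every strictly increasing `κ : ℕ → ℕ` has a sub-subsequence `κ ∘ σ` along whose meshes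
`1 / 2^(κ (σ n))` the bond-`ℤ²` crossing probabilities of `Q w` and `Q' w` converge for EVERY real
`w > 0`, to `g w` resp. `g' w`, with `g`, `g'` continuous on `(0, ∞)` and `g + g' = 1`.

Proof (the finite-mesh inputs `lr_local`, `bt_dual` are in the support file `…Boxes.lean`).
* Diagonal extraction over rational widths (`IsCompact.tendsto_subseq` in the compact,
  first-countable `ℚ → [0,1]`; `subseqLimits_mesh`).
* For every real `w` the sequence is squeezed by that of a nearby rational width up to `η`
  (`lr_local`: at each fine mesh `w ↦ P[Q w, ·]` is antitone and `η`-equicontinuous near `w`,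
  by `crossingProb_uniformIncrement`), hence Cauchy (`tendsto_of_approx`), hence convergent;
  continuity of the limit `g` on `(0, ∞)` by the same squeeze (`limits_of_ratLimits`).
* `P[Q' w, ·] → 1 - g w` by the finite-mesh duality squeeze `bt_dual`; `g' := 1 - g`.
* The dyadic meshes: `1 / 2^(κ (m+1)) = 1 / (k m + 2)` with `k m := 2^(κ (m+1)) - 2 → ∞`; the
  final sub-subsequence is `n ↦ σ n + 1`.

References: O. Schramm, S. Smirnov, Ann. Probab. 39 (2011), Lemma 6.1; B. Bollobás, O. Riordan,
*Percolation* (2006), Ch. 3 Lemma 1 and Ch. 7 §7.1; G. Grimmett, *Percolation* (1999), §11.7.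
-/

noncomputable section
open MeasureTheory Filter Set Metric Topology
open UpperHalfPlane (upperHalfPlaneSet)
open Literature.Probability.RandomPlanarGeometry Literature.Probability.LatticeModels
open Literature.Probability.Percolation
namespace Summit.CriticalPhenomena.CardyFormulaZ2.Cruxes.DyadicLatticeBetaLaw.Stubs

namespace RectSubseqLimits

variable {Q Q' : ℝ → ConformalRectangle}

/-! ### Limits along a sequence of meshes `1/(k n + 2)`, `k n → ∞` -/

/-- A real sequence which is within `ε` of a constant eventually, for every `ε > 0`, converges
(it is Cauchy). [folklore] -/
theorem tendsto_of_approx {u : ℕ → ℝ}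
    (h : ∀ ε : ℝ, 0 < ε → ∃ L : ℝ, ∀ᶠ n in atTop, |u n - L| ≤ ε) :
    ∃ L : ℝ, Tendsto u atTop (𝓝 L) := by
  refine cauchySeq_tendsto_of_complete (Metric.cauchySeq_iff'.2 fun ε hε => ?_)
  obtain ⟨L, hL⟩ := h (ε / 3) (by positivity)
  obtain ⟨N, hN⟩ := eventually_atTop.1 hL
  refine ⟨N, fun n hn => ?_⟩
  have h1 := abs_le.1 (hN n hn)
  have h2 := abs_le.1 (hN N le_rfl)
  rw [Real.dist_eq, abs_lt]
  constructor <;> linarith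

/-- **From rational to real widths.** If along the meshes `1/(k n + 2)`, `k n → ∞`, the
left–right probabilities of the boxes `Q q` converge for every rational `q`, then for every real
`w > 0` the probabilities of `Q w` and `Q' w` converge, to `g w` and `1 - g w`, with `g`
continuous on `(0, ∞)` (squeeze by nearby rationals via `lr_local`; `bt_dual`).
[cite: BollobasRiordan2006, Ch. 7 §7.1] [cite: SchrammSmirnov2011, Lemma 6.1] -/
theorem limits_of_ratLimits
    (hQ : ∀ w : ℝ, 0 < w → (Q w).carrier = (Ioo (0 : ℝ) w ×ℂ Ioo (0 : ℝ) 1) ∧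
      (Q w).arc 0 = {z : ℂ | z.re = 0 ∧ z.im ∈ Icc (0 : ℝ) 1} ∧
      (Q w).arc 2 = {z : ℂ | z.re = w ∧ z.im ∈ Icc (0 : ℝ) 1})
    (hQ' : ∀ w : ℝ, 0 < w → (Q' w).carrier = (Ioo (0 : ℝ) w ×ℂ Ioo (0 : ℝ) 1) ∧
      (Q' w).arc 0 = {z : ℂ | z.im = 0 ∧ z.re ∈ Icc (0 : ℝ) w} ∧
      (Q' w).arc 2 = {z : ℂ | z.im = 1 ∧ z.re ∈ Icc (0 : ℝ) w})
    {k : ℕ → ℕ} (hk : Tendsto k atTop atTop) {G : ℚ → ℝ}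
    (hG : ∀ q : ℚ, Tendsto (fun n : ℕ => bondDomainCrossingProb (Q q) (1 / ((k n : ℝ) + 2)))
      atTop (𝓝 (G q))) :
    ∃ g : ℝ → ℝ, ContinuousOn g (Ioi 0) ∧
      ∀ w : ℝ, 0 < w →
        Tendsto (fun n : ℕ => bondDomainCrossingProb (Q w) (1 / ((k n : ℝ) + 2))) atTop
            (𝓝 (g w)) ∧
          Tendsto (fun n : ℕ => bondDomainCrossingProb (Q' w) (1 / ((k n : ℝ) + 2))) atTop
            (𝓝 (1 - g w)) := by
  -- convergence of the left–right probabilities for every real width (Cauchy by squeeze)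
  have hconv : ∀ w : ℝ, 0 < w → ∃ L : ℝ,
      Tendsto (fun n : ℕ => bondDomainCrossingProb (Q w) (1 / ((k n : ℝ) + 2))) atTop (𝓝 L) := by
    intro w hw
    refine tendsto_of_approx fun e he => ?_
    obtain ⟨ρ, hρ, -, K, hK⟩ := lr_local hQ hw (half_pos he)
    obtain ⟨q, hq1, hq2⟩ := exists_rat_btwn (by linarith : w - ρ < w)
    refine ⟨G q, ?_⟩
    filter_upwards [hk.eventually_ge_atTop K,
      Metric.tendsto_nhds.1 (hG q) (e / 2) (half_pos he)] with n hn hq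
    obtain ⟨h1, h2⟩ := hK (k n) hn q w hq1 hq2.le (by linarith)
    rw [Real.dist_eq, abs_lt] at hq
    rw [abs_le]
    constructor <;> linarith
  choose! g hg using hconv
  -- continuity of `g` on `(0, ∞)` by the same squeeze
  have hgc : ContinuousOn g (Ioi 0) := by
    intro w₀ hw₀
    replace hw₀ : 0 < w₀ := hw₀
    apply ContinuousAt.continuousWithinAt
    rw [Metric.continuousAt_iff]
    intro e he
    obtain ⟨ρ, hρ, hρw, K, hK⟩ := lr_local hQ hw₀ (half_pos he)
    refine ⟨ρ, hρ, fun w hw => ?_⟩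
    rw [Real.dist_eq, abs_lt] at hw
    have hw0 : 0 < w := by linarith
    rw [Real.dist_eq, abs_lt]
    rcases le_total w w₀ with h | h
    · have hev : ∀ᶠ n : ℕ in atTop,
          bondDomainCrossingProb (Q w₀) (1 / ((k n : ℝ) + 2)) ≤
              bondDomainCrossingProb (Q w) (1 / ((k n : ℝ) + 2)) ∧
            bondDomainCrossingProb (Q w) (1 / ((k n : ℝ) + 2)) ≤
              bondDomainCrossingProb (Q w₀) (1 / ((k n : ℝ) + 2)) + e / 2 := by
        filter_upwards [hk.eventually_ge_atTop K] with n hn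
        exact hK (k n) hn w w₀ (by linarith) h (by linarith)
      have i1 : g w₀ ≤ g w :=
        le_of_tendsto_of_tendsto (hg w₀ hw₀) (hg w hw0) (hev.mono fun n hn => hn.1)
      have i2 : g w ≤ g w₀ + e / 2 :=
        le_of_tendsto_of_tendsto (hg w hw0) ((hg w₀ hw₀).add_const (e / 2))
          (hev.mono fun n hn => hn.2)
      constructor <;> linarith
    · have hev : ∀ᶠ n : ℕ in atTop,
          bondDomainCrossingProb (Q w) (1 / ((k n : ℝ) + 2)) ≤
              bondDomainCrossingProb (Q w₀) (1 / ((k n : ℝ) + 2)) ∧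
            bondDomainCrossingProb (Q w₀) (1 / ((k n : ℝ) + 2)) ≤
              bondDomainCrossingProb (Q w) (1 / ((k n : ℝ) + 2)) + e / 2 := by
        filter_upwards [hk.eventually_ge_atTop K] with n hn
        exact hK (k n) hn w₀ w (by linarith) h (by linarith)
      have i1 : g w ≤ g w₀ :=
        le_of_tendsto_of_tendsto (hg w hw0) (hg w₀ hw₀) (hev.mono fun n hn => hn.1)
      have i2 : g w₀ ≤ g w + e / 2 :=
        le_of_tendsto_of_tendsto (hg w₀ hw₀) ((hg w hw0).add_const (e / 2))
          (hev.mono fun n hn => hn.2)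
      constructor <;> linarith
  -- the bottom–top probabilities converge to `1 - g w`
  refine ⟨g, hgc, fun w hw => ⟨hg w hw, ?_⟩⟩
  rw [Metric.tendsto_nhds]
  intro e he
  obtain ⟨K, hK⟩ := bt_dual hQ hQ' hw (η := e / 4) (by positivity)
  filter_upwards [hk.eventually_ge_atTop K,
    Metric.tendsto_nhds.1 (hg w hw) (e / 2) (half_pos he)] with n hn h2
  obtain ⟨h3, h4⟩ := hK (k n) hn
  rw [Real.dist_eq, abs_lt] at h2 ⊢
  constructor <;> linarith

/-- **Diagonal extraction.** Along a subsequence `σ` of any sequence of meshes `1/(k n + 2)`,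
`k n → ∞`, the left–right probabilities of the boxes `Q q` converge for every rational `q`
(`IsCompact.tendsto_subseq` in the compact, first-countable `ℚ → [0, 1]`); then
`limits_of_ratLimits`. [cite: BollobasRiordan2006, Ch. 7 §7.1] -/
theorem subseqLimits_mesh
    (hQ : ∀ w : ℝ, 0 < w → (Q w).carrier = (Ioo (0 : ℝ) w ×ℂ Ioo (0 : ℝ) 1) ∧
      (Q w).arc 0 = {z : ℂ | z.re = 0 ∧ z.im ∈ Icc (0 : ℝ) 1} ∧
      (Q w).arc 2 = {z : ℂ | z.re = w ∧ z.im ∈ Icc (0 : ℝ) 1})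
    (hQ' : ∀ w : ℝ, 0 < w → (Q' w).carrier = (Ioo (0 : ℝ) w ×ℂ Ioo (0 : ℝ) 1) ∧
      (Q' w).arc 0 = {z : ℂ | z.im = 0 ∧ z.re ∈ Icc (0 : ℝ) w} ∧
      (Q' w).arc 2 = {z : ℂ | z.im = 1 ∧ z.re ∈ Icc (0 : ℝ) w})
    {k : ℕ → ℕ} (hk : Tendsto k atTop atTop) :
    ∃ σ : ℕ → ℕ, StrictMono σ ∧ ∃ g : ℝ → ℝ, ContinuousOn g (Ioi 0) ∧
      ∀ w : ℝ, 0 < w →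
        Tendsto (fun n : ℕ => bondDomainCrossingProb (Q w) (1 / ((k (σ n) : ℝ) + 2))) atTop
            (𝓝 (g w)) ∧
          Tendsto (fun n : ℕ => bondDomainCrossingProb (Q' w) (1 / ((k (σ n) : ℝ) + 2))) atTop
            (𝓝 (1 - g w)) := by
  have hS : IsCompact (Set.pi Set.univ fun _ : ℚ => Icc (0 : ℝ) 1) :=
    isCompact_univ_pi fun _ => isCompact_Icc
  obtain ⟨G, -, σ, hσ, hG⟩ := hS.tendsto_subseq
    (x := fun (n : ℕ) (q : ℚ) => bondDomainCrossingProb (Q q) (1 / ((k n : ℝ) + 2)))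
    (fun n => Set.mem_univ_pi.2 fun q => bondDomainCrossingProb_mem_Icc _ _)
  rw [tendsto_pi_nhds] at hG
  exact ⟨σ, hσ, limits_of_ratLimits hQ hQ' (hk.comp hσ.tendsto_atTop) (G := G) fun q => hG q⟩

end RectSubseqLimits

open RectSubseqLimits in
/-- **STUB S5a — subsequential limits of the corner-marked boxes** (pure percolation). For the
left–right family `Q w` and the bottom–top family `Q' w` of boxes `(0,w) × (0,1)` (specified by
carrier and arcs `0, 2`), every strictly increasing `κ` has a sub-subsequence `κ ∘ σ` along
whose meshes `1/2^(κ (σ n))` the crossing probabilities of `Q w` and `Q' w` converge for EVERY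
real `w > 0`, to `g w` resp. `g' w`, with `g`, `g'` continuous on `(0, ∞)` and `g w + g' w = 1`:
diagonal extraction over rational widths (`subseqLimits_mesh`), mesh-uniform equicontinuity in
the width (`crossingProb_uniformIncrement` via `lr_local`), exact identification with lattice
box crossings (`RectangleDuality.bond_lr_eq`, `bond_bt_le`, `le_bond_bt`) and exact duality
(`crossingProb_add_crossingProb_symm_holds` via `bt_dual`); the dyadic meshes are
`1 / 2^(κ (m+1)) = 1 / (k m + 2)`, `k m := 2^(κ (m+1)) - 2 → ∞`. Schramm–Smirnov 2011 Lemma 6.1;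
Bollobás–Riordan 2006 Ch. 3 Lemma 1 and Ch. 7 §7.1. -/
theorem stub_rectSubseqLimits :
    ∀ (Q Q' : ℝ → ConformalRectangle),
      (∀ w : ℝ, 0 < w → (Q w).carrier = (Set.Ioo (0 : ℝ) w ×ℂ Set.Ioo (0 : ℝ) 1) ∧
        (Q w).arc 0 = {z : ℂ | z.re = 0 ∧ z.im ∈ Set.Icc (0 : ℝ) 1} ∧
        (Q w).arc 2 = {z : ℂ | z.re = w ∧ z.im ∈ Set.Icc (0 : ℝ) 1}) →
      (∀ w : ℝ, 0 < w → (Q' w).carrier = (Set.Ioo (0 : ℝ) w ×ℂ Set.Ioo (0 : ℝ) 1) ∧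
        (Q' w).arc 0 = {z : ℂ | z.im = 0 ∧ z.re ∈ Set.Icc (0 : ℝ) w} ∧
        (Q' w).arc 2 = {z : ℂ | z.im = 1 ∧ z.re ∈ Set.Icc (0 : ℝ) w}) →
      ∀ κ : ℕ → ℕ, StrictMono κ → ∃ σ : ℕ → ℕ, StrictMono σ ∧ ∃ g g' : ℝ → ℝ,
        ContinuousOn g (Set.Ioi 0) ∧ ContinuousOn g' (Set.Ioi 0) ∧
        (∀ w : ℝ, 0 < w → g w + g' w = 1) ∧
        ∀ w : ℝ, 0 < w →
          Tendsto (fun n : ℕ => bondDomainCrossingProb (Q w) (1 / 2 ^ (κ (σ n)))) atTop (𝓝 (g w)) ∧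
          Tendsto (fun n : ℕ => bondDomainCrossingProb (Q' w) (1 / 2 ^ (κ (σ n)))) atTop
            (𝓝 (g' w)) := by
  intro Q Q' hQ hQ' κ hκ
  have hκle : ∀ m : ℕ, m ≤ κ m := fun m => hκ.id_le m
  have h2le : ∀ m : ℕ, 2 ≤ 2 ^ κ (m + 1) := fun m =>
    calc 2 = 2 ^ 1 := rfl
      _ ≤ 2 ^ κ (m + 1) := Nat.pow_le_pow_right two_pos ((Nat.le_add_left 1 m).trans (hκle _))
  -- the dyadic meshes `1 / 2^(κ (m+1)) = 1 / (k m + 2)`, `k m := 2^(κ (m+1)) - 2 → ∞`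
  have hmesh : ∀ m : ℕ,
      (1 : ℝ) / (((2 ^ κ (m + 1) - 2 : ℕ) : ℝ) + 2) = 1 / 2 ^ κ (m + 1) := by
    intro m
    rw [Nat.cast_sub (h2le m)]
    push_cast
    ring
  have hk : Tendsto (fun m : ℕ => 2 ^ κ (m + 1) - 2) atTop atTop := by
    refine tendsto_atTop_mono (fun m => ?_) tendsto_id
    have h1 : m + 1 < 2 ^ (m + 1) := Nat.lt_two_pow_self
    have h2 : 2 ^ (m + 1) ≤ 2 ^ κ (m + 1) := Nat.pow_le_pow_right two_pos (hκle _)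
    show m ≤ 2 ^ κ (m + 1) - 2
    omega
  obtain ⟨σ, hσ, g, hgc, hlim⟩ := subseqLimits_mesh hQ hQ' hk
  have hg'c : ContinuousOn (fun w => 1 - g w) (Ioi 0) := continuousOn_const.sub hgc
  have hsum : ∀ w : ℝ, 0 < w → g w + (1 - g w) = 1 := fun w _ => by ring
  refine ⟨fun n => σ n + 1, fun a b h => Nat.succ_lt_succ (hσ h), g, fun w => 1 - g w, hgc, hg'c,
    hsum, fun w hw => ?_⟩
  obtain ⟨h1, h2⟩ := hlim w hw
  constructor
  · refine h1.congr fun n => ?_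
    show bondDomainCrossingProb (Q w) (1 / (((2 ^ κ (σ n + 1) - 2 : ℕ) : ℝ) + 2)) =
      bondDomainCrossingProb (Q w) (1 / 2 ^ κ (σ n + 1))
    rw [hmesh]
  · refine h2.congr fun n => ?_
    show bondDomainCrossingProb (Q' w) (1 / (((2 ^ κ (σ n + 1) - 2 : ℕ) : ℝ) + 2)) =
      bondDomainCrossingProb (Q' w) (1 / 2 ^ κ (σ n + 1))
    rw [hmesh]

end Summit.CriticalPhenomena.CardyFormulaZ2.Cruxes.DyadicLatticeBetaLaw.Stubs

end
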